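import Literature.MathematicalPhysics.QuantumFieldTheory.Balaban1983to89.B9Eq343LocalHolderFlat

/-!
# `Balaban1983to89.B9Eq3152StoreyHOfHLb` — T. Bałaban, *The variational problem and background fields in renormalization group method for lattice gauge
# theories*, Commun. Math. Phys. **102** (1985) 277–309 [Balaban1985Variational] (117) p. 295, with *Propagators for lattice gauge theories in a background field*,
# Commun. Math. Phys. **99** (1985) 389–434 [Balaban1985BackgroundPropagators] Thm 3.13 p. 426, Thm 3.1 (3.42)–(3.44) pp. 397–398: **THE (117) SOCKET
# `‖toCLM115 ∇_U 𝔊̃_k‖ ≤ max(w̄₀B, w̄₁B)·w̲⁻¹` FOR THE FULL `𝔊̃_k` ON THE MODEL NOW RESTS ON (HLb) = Thm 3.1 (3.44) ALONE** — the local flat Hölder letter `Hloc`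
# of `B9Eq343FlatWindowLetterOfLocalHolder` is DISCHARGED by `B9Eq343LocalHolderFlat.exists_localHolder_flat` (β = ½), so (HLaH) = Thm 3.1 (3.43)₂ for
# `G′_k(U)D*_U` on the model is closed and STOREY H's headline keeps ONE displayed printed member.  NE9 crux-team LEAF PROVER 01, gen 94.

statement-level skeleton of published theorems with citation tags; proofs where landed; nothing here is a claim about the Yang–Mills mass gap

CITATION HEADER (lean-in-tree rule).  Audit cell `pub-balaban`, sub-cell `t4`, BINDER row NE9; filed by NE9 crux-team LEAF PROVER 01
(`b2b-balaban-t4-ne9-formalise-leaf-01`, gen 94; bears_on: R4/N22).  Source READ first-hand (`paper:balaban1985-cmp102-variational-background` p. 295;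
`paper:balaban1985-cmp99-background-propagators`, pp. 397–398, 426).  COMPOSED BY NAME: `B9Eq343FlatWindowLetterOfLocalHolder.exists_norm_toCLM115_frakGkPi_le_of_localHolder_hessian`
at `β := ½`, `Cloc` and `Hloc` := `B9Eq343LocalHolderFlat.exists_localHolder_flat`.  Nothing printed is a hypothesis except (HLb) (DISPLAYED, verbatim as before).

WHAT IS PROVED (sorry-free; proof lane — 0 `def`).
* **`exists_norm_toCLM115_frakGkPi_le_of_hessian`** — the (117) socket for the FULL `𝔊̃_k` on the model ⇐ (HLb) = Thm 3.1 (3.44) for `G′_k` (the second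
  covariant-derivative row for block-localised Hölder data) ALONE.
HONEST SCOPE.  (HLaH) = (3.43)₂ for `G′_kD*_U` on the model is PROVED through `Hloc` (discrete Campanato road on `ℤ^d`, `B4Eq19Lattice*`); (HLb) = (3.44)
remains DISPLAYED — the ONE open printed member behind STOREY H.  NOT summit progress (cell pub-balaban: NE9 NOT PRINTED ∕ NOT PROVED; «NE9 ⇐ the named
binders»; row WALLED ON A MODEL (O-NE9-1; #5 UNRULED); spine PROVED 0∕9; rung (B)+1 finite T⁴ — NOT infinite volume, NOT mass gap, NOT BetaPertH, NOT Clay).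
HONEST DEPENDENCY (cell line): continuum YM on T⁴ ⇐ BetaPertH ∧ nine spine estimates (0/9 proved); BetaPertH ⇐ (D1) ∧ (D4) ∧ CAP+tail; G-an2-4 gates asym,
D1 and NE2/3/4.  NEW file; nothing modified.  Net new unproved facts: 0.
-/

noncomputable section

set_option autoImplicit false

open scoped InnerProductSpace ComplexConjugate BigOperators

namespace Literature.MathematicalPhysics.QuantumFieldTheory.Balaban1983to89.B9Eq3152StoreyHOfHLb

open B9Eq343FlatWindowLetterOfLocalHolder (exists_norm_toCLM115_frakGkPi_le_of_localHolder_hessian)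
open B9Eq343LocalHolderFlat (exists_localHolder_flat)

section Socket

open B4Sect5Torus (TSite tdist tdist_nonneg)
open B9SectCLatticeCarrier (Bond bpos btgt unshift)
open B9Eq311L2Pairing (WL2)
open B9Eq319QprimeTorus (fineP blockCoord)
open B7Prop1Explicit (U1 Wcx boxVec)
open B11Eq103H1Complex (SiteL2K BondL2K greenK covDerivL2K covDivL2K covLaplaceSiteK G1LatticeK frakGLatticeK)
open B9Eq310DeltaPrime (plaqHolU)
open B9Eq310HessianOperator (adTransportW)
open B9Eq315QTorus (perCfg cornerSite)
open B9Eq315QTower (towerP UlevOf)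
open B9Eq316TowerFlatIsOneStep (towerP_eq_fineP_pow siteCast)
open B9Eq326OperatorTower (QprimeTowerW RofUk laplaceAk QkW)
open B9Eq3119DeltaPiTower (laplaceAkPi)
open B9Eq324DeltaPrimeATower (laplacePrimeAk GpOfUk)
open B9Eq325ProjFormulaTower (QGGQk_pos_of_unitary)
open B9Eq33CovDerivVector (covGrad)
open B11Eq115Space (NegSup levWeight)
open B11Eq111FrakG (toCLM115)
open B9Eq3152StoreyHTwoHolderMembers (exists_norm_toCLM115_frakGkPi_le_of_twoHolderMembers)
open B9Eq342GreenPrimeDstarValueRowTower (exists_valueRow_GpOfUk_covDiv)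
open B4TorusKernel.MultiPeriod (circAbs)
open B9Eq3152StoreyHOfFlatWindowLetter (exists_norm_toCLM115_frakGkPi_le_of_flatWindow_hessian)

variable {d : ℕ} (hd : 1 ≤ d) (L : ℕ) [NeZero L] (hL : 1 ≤ L) (hL3 : 3 ≤ L)
  {𝔸 : Type*} [NormedRing 𝔸] [NormedAlgebra ℂ 𝔸] [CompleteSpace 𝔸] [NormOneClass 𝔸] [StarRing 𝔸] [NormedStarGroup 𝔸] [StarModule ℂ 𝔸]
  {W : Type*} [NormedAddCommGroup W] [InnerProductSpace ℂ W] [FiniteDimensional ℂ W] (φ : W ≃ₗ[ℂ] 𝔸)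
  {Mφ Mφ' : ℝ} (hMφ : 0 ≤ Mφ) (hMφ' : 0 ≤ Mφ') (hφ : ∀ w, ‖φ w‖ ≤ Mφ * ‖w‖) (hφ' : ∀ X, ‖φ.symm X‖ ≤ Mφ' * ‖X‖) (hstar : ∀ X : 𝔸, ‖star X‖ ≤ ‖X‖)
  {a : ℝ} (ha : 0 < a) {a' : ℝ} (ha' : 0 < a') {ϱ : ℝ} (hϱ0 : 0 ≤ ϱ) (hϱ1 : ϱ < 1)
  (τ : 𝔸 →ₗ[ℂ] ℂ) {Cτ : ℝ} (hτ : ∀ X, ‖τ X‖ ≤ Cτ * ‖X‖) (hCτ : 0 ≤ Cτ) {Mτ : ℝ} (hτm : ∀ X Y : 𝔸, ‖τ (X * Y)‖ ≤ Mτ * ‖X‖ * ‖Y‖) (hMτ : 0 ≤ Mτ)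
  {ρw : ℝ} (hρw : 0 ≤ ρw)
  (hτ₁ : ∀ X : 𝔸, τ (star X) = conj (τ X)) (hτ₂ : ∀ X Y : 𝔸, τ (X * Y) = τ (Y * X)) (hφτ : ∀ X Y : 𝔸, ⟪φ.symm X, φ.symm Y⟫_ℂ = τ (star X * Y))
  (AQ : ℝ)

set_option maxHeartbeats 800000 in -- three ≈ 50-binder blocks
include hd hL hL3 hMφ hMφ' hφ hφ' hstar ha ha' hϱ0 hϱ1 hτ hCτ hτm hMτ hρw hτ₁ hτ₂ hφτ in
/-- **THE HEADLINE OF STOREY H WITH (HLaH) DISCHARGED: the (117) socket `‖toCLM115 ∇_U 𝔊̃_k‖ ≤ max(w̄₀B, w̄₁B)·w̲⁻¹` for the FULL `𝔊̃_k` ON THE MODEL from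
(HLb) = Thm 3.1 (3.44) for `G′_k` ALONE** — `B9Eq343FlatWindowLetterOfLocalHolder.exists_norm_toCLM115_frakGkPi_le_of_localHolder_hessian` at `β = ½` with
`Hloc := B9Eq343LocalHolderFlat.exists_localHolder_flat` (the local flat `C^{1∕2}` estimate, PROVED by the discrete Campanato road on `ℤ^d`).
[cite: Balaban1985Variational, (117) p.295; Balaban1985BackgroundPropagators, Thm 3.13 p.426, Thm 3.1 (3.42)–(3.44) pp.397–398, (3.152)–(3.153) p.426, (3.25) p.394] -/
theorem exists_norm_toCLM115_frakGkPi_le_of_hessian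
    (HLb : ∀ ε : ℝ, 0 < ε → ε ≤ 1 → ∃ αb Bb δb : ℝ, 0 < αb ∧ 0 ≤ Bb ∧ 0 < δb ∧
      ∀ (n : ℕ) (η : ℝ) (_hηL : η * (L : ℝ) ^ (n + 1) = 1) (c₀ c₁ : ℝ) [Fact (0 < c₀)] [Fact (0 < c₁)]
        (_hw : c₀ * ((L : ℝ) ^ (n + 1)) ^ d = c₁) (_hρ : |η| ^ d / c₀ ≤ ρw) (m : Fin d → ℕ) [∀ i, NeZero (m i)] (_hm : ∀ i, 1 ≤ m i)
        (U : Bond d (towerP L m (n + 1)) → 𝔸ˣ) (αU : ℕ → ℝ) (_hα0 : ∀ j, 0 ≤ αU j) (hα1 : ∀ j, αU j ≤ 1 / 64)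
        (hU1 : ∀ (j : ℕ) (x : B7Prop1Explicit.Site d) (k : Fin d), perCfg (towerP L m (j + 1)) (UlevOf L m (n + 1) U j) x k ∈ U1 𝔸)
        (hreg : ∀ (j : ℕ) (y : TSite d (towerP L m j)) (k : Fin d) (ρ' : Fin d → Fin L),
          ‖((Wcx L (perCfg (towerP L m (j + 1)) (UlevOf L m (n + 1) U j)) (cornerSite L y) k (boxVec L ρ') : 𝔸ˣ) : 𝔸) - 1‖ ≤ αU j)
        (εU : ℕ → ℝ) (_hεU : ∀ j, 0 ≤ εU j) (_hUε : ∀ (j : ℕ) (b : Bond d (towerP L m (j + 1))), ‖(UlevOf L m (n + 1) U j b : 𝔸) - 1‖ ≤ εU j)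
        (_hLb : ∀ (j : ℕ) (b : Bond d (towerP L m (j + 1))), UlevOf L m (n + 1) U j b ∈ U1 𝔸)
        (α : ℝ) (_hα : 0 ≤ α) (_hαle : α ≤ αb)
        (hUst : ∀ b, star (U b : 𝔸) = (((U b)⁻¹ : 𝔸ˣ) : 𝔸)) (_hUb : ∀ b, U b ∈ U1 𝔸) (_hUη : ∀ b, ‖(U b : 𝔸) - 1‖ ≤ α * η)
        (_hpl : ∀ p : B9SectCLatticeCarrier.Plaq d (towerP L m (n + 1)), ‖(plaqHolU U p : 𝔸) - 1‖ ≤ α * η ^ 2)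
        (_hUgrad : ∀ (x : TSite d (towerP L m (n + 1))) (μ : Fin d), ‖(U (x, μ) : 𝔸) - U (unshift μ x, μ)‖ ≤ α * η ^ 2)
        (_hRlev : ∀ (j : ℕ) (b : Bond d (towerP L m (j + 1))) (w : W), ‖adTransportW φ (UlevOf L m (n + 1) U j) b w‖ ≤ ‖w‖)
        (_hεg : ∀ j < n + 1, εU j ≤ α * ϱ ^ j) (_hAQ : ∑ j ∈ Finset.range (n + 1), αU j ≤ AQ)
        (hpos' : ∀ x : SiteL2K ℂ d (towerP L m (n + 1)) c₀ W, x ≠ 0 → 0 < RCLike.re ⟪x, laplacePrimeAk L m n φ η U a' (c₁ := c₁) x⟫_ℂ)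
        (hpos : ∀ x : BondL2K ℂ d (towerP L m (n + 1)) c₀ W, x ≠ 0 →
          0 < RCLike.re ⟪x, laplaceAk L m n φ η U hL αU hα1 hU1 hreg τ (c₀ := c₀) (c₁ := c₁) a x⟫_ℂ)
        (hposπ : ∀ x : BondL2K ℂ d (towerP L m (n + 1)) c₀ W, x ≠ 0 →
          0 < RCLike.re ⟪x, laplaceAkPi L m n φ τ η U a' hpos' hL αU hα1 hU1 hreg (c₁ := c₁) a x⟫_ℂ)
        (_hc₀ : c₀ = η ^ d)
        (_hJ : ∀ (μ : Fin d) (y : TSite d (towerP L m (n + 1))),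
          ‖B9Eq39Adjoint.J (fun μ => B9Eq33CovDerivVector.shiftEquiv μ) (fun μ y => U (y, μ)) η μ y‖ ≤ α)
        (y' : TSite d m) (lam : SiteL2K ℂ d (towerP L m (n + 1)) c₀ W) (N H : ℝ) (_hN : 0 ≤ N) (_hH : 0 ≤ H)
        (_hsupp : ∀ x, WL2.equiv ℂ (fun _ : TSite d (towerP L m (n + 1)) => c₀) W lam x ≠ 0 → tdist m (blockCoord (L ^ (n + 1)) m (siteCast (towerP_eq_fineP_pow L m (n + 1)) x)) y' ≤ 1)
        (_hval : ∀ x, ‖WL2.equiv ℂ (fun _ : TSite d (towerP L m (n + 1)) => c₀) W lam x‖ ≤ N)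
        (_hhol : ∀ x x' : TSite d (towerP L m (n + 1)), tdist (towerP L m (n + 1)) x x' ≤ ((L ^ (n + 1) : ℕ) : ℝ) →
          ‖WL2.equiv ℂ (fun _ : TSite d (towerP L m (n + 1)) => c₀) W lam x' - WL2.equiv ℂ (fun _ : TSite d (towerP L m (n + 1)) => c₀) W lam x‖ ≤ H * (tdist (towerP L m (n + 1)) x x' / ((L ^ (n + 1) : ℕ) : ℝ)) ^ ε)
        (μ : Fin d) (b : Bond d (towerP L m (n + 1))),
        ‖WL2.equiv ℂ (fun _ : Bond d (towerP L m (n + 1)) => c₀) W (covDerivL2K ℂ c₀ ((η : ℂ))⁻¹ (adTransportW φ U)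
            ((WL2.equiv ℂ (fun _ : TSite d (towerP L m (n + 1)) => c₀) W).symm fun y => WL2.equiv ℂ (fun _ : Bond d (towerP L m (n + 1)) => c₀) W (covDerivL2K ℂ c₀ ((η : ℂ))⁻¹ (adTransportW φ U) (GpOfUk L m n φ η U a' (c₁ := c₁) hpos' lam)) (y, μ))) b‖ ≤
          Bb * Real.exp (-(δb * tdist m (blockCoord (L ^ (n + 1)) m (siteCast (towerP_eq_fineP_pow L m (n + 1)) (bpos b))) y')) * (N + H)) :
    ∃ α₁ j₁ B : ℝ, 0 < α₁ ∧ 0 < j₁ ∧ 0 ≤ B ∧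
      ∀ (n : ℕ) (η : ℝ) (_hηL : η * (L : ℝ) ^ (n + 1) = 1) (c₀ c₁ : ℝ) [Fact (0 < c₀)] [Fact (0 < c₁)]
        (_hw : c₀ * ((L : ℝ) ^ (n + 1)) ^ d = c₁) (_hρ : |η| ^ d / c₀ ≤ ρw) (m : Fin d → ℕ) [∀ i, NeZero (m i)] (_hm : ∀ i, 1 ≤ m i)
        (U : Bond d (towerP L m (n + 1)) → 𝔸ˣ) (αU : ℕ → ℝ) (_hα0 : ∀ j, 0 ≤ αU j) (hα1 : ∀ j, αU j ≤ 1 / 64)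
        (hαL : ∀ j, 50 * (d + 1) * αU j * (L : ℝ) ^ d ≤ 1 / 2)
        (hU1 : ∀ (j : ℕ) (x : B7Prop1Explicit.Site d) (k : Fin d), perCfg (towerP L m (j + 1)) (UlevOf L m (n + 1) U j) x k ∈ U1 𝔸)
        (hreg : ∀ (j : ℕ) (y : TSite d (towerP L m j)) (k : Fin d) (ρ' : Fin d → Fin L),
          ‖((Wcx L (perCfg (towerP L m (j + 1)) (UlevOf L m (n + 1) U j)) (cornerSite L y) k (boxVec L ρ') : 𝔸ˣ) : 𝔸) - 1‖ ≤ αU j)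
        (εU : ℕ → ℝ) (_hεU : ∀ j, 0 ≤ εU j) (_hUε : ∀ (j : ℕ) (b : Bond d (towerP L m (j + 1))), ‖(UlevOf L m (n + 1) U j b : 𝔸) - 1‖ ≤ εU j)
        (_hLb : ∀ (j : ℕ) (b : Bond d (towerP L m (j + 1))), UlevOf L m (n + 1) U j b ∈ U1 𝔸)
        (α : ℝ) (_hα : 0 ≤ α) (_hαle : α ≤ α₁)
        (hUst : ∀ b, star (U b : 𝔸) = (((U b)⁻¹ : 𝔸ˣ) : 𝔸)) (_hUb : ∀ b, U b ∈ U1 𝔸) (_hUη : ∀ b, ‖(U b : 𝔸) - 1‖ ≤ α * η)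
        (_hpl : ∀ p : B9SectCLatticeCarrier.Plaq d (towerP L m (n + 1)), ‖(plaqHolU U p : 𝔸) - 1‖ ≤ α * η ^ 2)
        (_hUgrad : ∀ (x : TSite d (towerP L m (n + 1))) (μ : Fin d), ‖(U (x, μ) : 𝔸) - U (unshift μ x, μ)‖ ≤ α * η ^ 2)
        (_hRlev : ∀ (j : ℕ) (b : Bond d (towerP L m (j + 1))) (w : W), ‖adTransportW φ (UlevOf L m (n + 1) U j) b w‖ ≤ ‖w‖)
        (_hεg : ∀ j < n + 1, εU j ≤ α * ϱ ^ j) (_hAQ : ∑ j ∈ Finset.range (n + 1), αU j ≤ AQ)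
        (hpos' : ∀ x : SiteL2K ℂ d (towerP L m (n + 1)) c₀ W, x ≠ 0 → 0 < RCLike.re ⟪x, laplacePrimeAk L m n φ η U a' (c₁ := c₁) x⟫_ℂ)
        (hpos : ∀ x : BondL2K ℂ d (towerP L m (n + 1)) c₀ W, x ≠ 0 →
          0 < RCLike.re ⟪x, laplaceAk L m n φ η U hL αU hα1 hU1 hreg τ (c₀ := c₀) (c₁ := c₁) a x⟫_ℂ)
        (_hc₀η : c₀ = η ^ d) (j₀ : ℝ) (_hJ : ∀ μ y, ‖B9Eq39Adjoint.J (fun μ => B9Eq33CovDerivVector.shiftEquiv μ) (fun μ y => U (y, μ)) η μ y‖ ≤ j₀) (_hj : j₀ ≤ j₁)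
        (hposπ : ∀ x : BondL2K ℂ d (towerP L m (n + 1)) c₀ W, x ≠ 0 →
          0 < RCLike.re ⟪x, laplaceAkPi L m n φ τ η U a' hpos' hL αU hα1 hU1 hreg (c₁ := c₁) a x⟫_ℂ)
        (hQ : Function.Surjective (QkW L m n φ U hL αU hα1 hU1 hreg (c₀ := c₀) (c₁ := c₁)))
        (Lw ηw : ℝ) [Fact (0 < Lw)] [Fact (0 < ηw)] (lev₀ : Bond d (towerP L m (n + 1)) → ℕ) (lev₁ : Bond d (towerP L m (n + 1)) × Fin d → ℕ),
        ‖toCLM115 (L := Lw) (η := ηw) (lev₀ := lev₀) lev₁ (covGrad ((η : ℂ))⁻¹ (adTransportW φ U))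
            ((WL2.linearEquiv ℂ ℂ (fun _ : Bond d (towerP L m (n + 1)) => c₀)).toLinearMap ∘ₗ (frakGLatticeK hposπ hQ : _ →ₗ[ℂ] _) ∘ₗ
              ((WL2.linearEquiv ℂ ℂ (fun _ : Bond d (towerP L m (n + 1)) => c₀)).symm.toLinearMap :
                (Bond d (towerP L m (n + 1)) → W) →ₗ[ℂ] BondL2K ℂ d (towerP L m (n + 1)) c₀ W))‖ ≤
          max ((NegSup.wSup (levWeight Lw ηw lev₀ 1) : ℝ) * B) (NegSup.wSup (levWeight Lw ηw lev₁ 2) * B) *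
            NegSup.wInvSup (levWeight Lw ηw lev₀ 3) := by
  obtain ⟨Cloc, hCloc, hloc⟩ := exists_localHolder_flat (d := d) L (W := W)
  exact exists_norm_toCLM115_frakGkPi_le_of_localHolder_hessian hd L hL hL3 φ hMφ hMφ' hφ hφ' hstar ha ha' hϱ0 hϱ1 τ hτ hCτ hτm hMτ hρw hτ₁ hτ₂ hφτ AQ
    (β := (1 : ℝ) / 2) (by norm_num) (by norm_num) Cloc hCloc hloc HLb

end Socket

end Literature.MathematicalPhysics.QuantumFieldTheory.Balaban1983to89.B9Eq3152StoreyHOfHLb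

end
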